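import Mathlib.RingTheory.MvPolynomial.EulerIdentity
import Mathlib.Algebra.MvPolynomial.Derivation
import Mathlib.Algebra.MvPolynomial.Equiv
import Mathlib.Algebra.MvPolynomial.PDeriv
import Mathlib.RingTheory.Derivation.Lie
import Mathlib.Algebra.Polynomial.Roots
import Mathlib.Algebra.Polynomial.Derivative
import Mathlib.LinearAlgebra.Matrix.Determinant.Basic
import Mathlib.LinearAlgebra.Matrix.Notation
import Mathlib.Algebra.CharZero.Infinite
import Mathlib.Tactic.FieldSimp
import Mathlib.Tactic.LinearCombination
import Mathlib.Tactic.Positivity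
import Mathlib.Tactic.Ring
import HarnessLib

/-!
# Unipotent-fixed polynomials of weight zero are `SL₂`-fixed (two-row polynomial model)

Topic `Literature/RepresentationTheory/ClassicalInvariants`. THEOREMS ONLY (no named fact, no instance,
D-0026): an elementary piece of the representation theory of `SL₂` in the concrete model used by the
tree's Kronecker-coefficient files (`Literature.NumberTheory.DiophantineGeometry.KroneckerTriplePoly`):
the polynomial ring `k[X_{(p, a)} : p ∈ {0, 1}, a ∈ τ]` ("two rows of variables indexed by `τ`"), on
which `GL₂(k)` acts by substituting the row index (`rowSubst g : X_{(q,a)} ↦ Σ_{p} g_{p q} X_{(p,a)}`,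
the column convention of the tree's `linSubst` / `legSubst₁`).

**Theorem** (`rowSubst_eq_self_of_shear`). Let `k` be a field of characteristic `0` and let `f` be
bihomogeneous of bidegree `(δ, δ)` (degree `δ` in the row-`0` variables and degree `δ` in the row-`1`
variables). If `f` is fixed by every upper shear `X_{(1,a)} ↦ X_{(1,a)} + t X_{(0,a)}` (`t ∈ k`), then
`f` is fixed by `rowSubst g` for every `g ∈ SL₂(k)`.

This is the statement "a highest-weight vector of `h`-weight `0` in a locally finite `SL₂`-module spans
the trivial representation" (Fulton–Harris, *Representation Theory*, §11.1; Goodman–Wallach, GTM 255,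
§2.3.1), proved here without any structure theory, through the infinitesimal `sl₂`-triple of
POLARIZATION operators on the polynomial ring:

* `polar p q = Σ_a X_{(p,a)} ∂/∂X_{(q,a)}` ("replace the letter `q` by `p`"; `E = polar 0 1`,
  `F = polar 1 0`) and the Euler operators `euler p = Σ_a X_{(p,a)} ∂/∂X_{(p,a)}`; the relations
  `[E, F] = euler 0 - euler 1`, `[euler 0 - euler 1, F] = -2F` (`lie_polar_polar`, `lie_euler_polar`);
* the dictionary between the one-parameter unipotent group and its generator, both directions, via the
  substitution with a polynomial parameter `T` (`shearT`) and `∂/∂T ∘ shearT = shearT ∘ polar`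
  (`pderiv_none_shearT`): fixed by all shears `⇒` killed by `polar` (`polar_eq_zero_of_forall_shear`,
  uses that `k` is infinite) and killed by `polar` `⇒` fixed by all shears
  (`shear_eq_self_of_polar_eq_zero`, uses characteristic `0`: a polynomial in `T` with zero derivative
  is constant);
* the `sl₂` string computation `E F^{n+1} f = -n(n+1) F^n f` for `E f = 0`, `(euler 0 - euler 1) f = 0`
  (`polar_iterate_succ`), the nilpotency `F^{δ+1} f = 0` (bidegree bookkeeping,
  `iterate_polar_eq_zero`) and the downward induction giving `F f = 0` (`polar_swap_eq_zero`);
* generation of `SL₂(k)` by the two root groups and the torus in the explicit form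
  `g = L(c/a) · diag(a, a⁻¹) · U(b/a)` (`a = g₀₀ ≠ 0`) resp. after one extra shear when `g₀₀ = 0`
  (`rowSubst_eq_self_of_shear`).

Consumers: `Literature.Computability.AlgebraicComplexity.TwoByTwoTupleSemiInvariants` (the rectangular
Kronecker coefficients `g((δ,δ),(δ,δ),π)`, BLMW 2011 Prop. 8.1), where the two "legs" of
`k[X_{((l,i),j)}]` carrying the weight `(δ, δ)` are brought to this form by `MvPolynomial.rename`.

## References

* W. Fulton, J. Harris, *Representation Theory*, GTM 129, §11.1 (representations of `sl₂ℂ`), §8.2/§15.3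
  (polarization). [key `FultonHarrisGTM129`]
* R. Goodman, N. R. Wallach, *Symmetry, Representations, and Invariants*, GTM 255, §2.3.1–2.3.2
  (`SL₂`, highest weight vectors), §1.3 (one-parameter subgroups). [key `GoodmanWallachGTM255`]

## Mathlib

`MvPolynomial.mkDerivation`, `MvPolynomial.derivation_ext`, `MvPolynomial.pderiv`,
`MvPolynomial.IsWeightedHomogeneous.sum_weight_X_mul_pderiv` (Euler), `IsWeightedHomogeneous.pderiv`,
`MvPolynomial.optionEquivLeft`, `Polynomial.eq_zero_of_infinite_isRoot`,
`Polynomial.eq_C_of_derivative_eq_zero`, `Derivation.commutator_apply`. Mathlib's `IsSl2Triple` API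
(`Mathlib.Algebra.Lie.Sl2`) is finite-dimensional in its conclusions; the two inductions needed here are
re-done by hand in the present (infinite-dimensional, locally nilpotent) situation.
-/

noncomputable section

open MvPolynomial
open scoped BigOperators

namespace Literature.RepresentationTheory.ClassicalInvariants.TwoRowSl2

variable {k : Type*} [Field k] {τ : Type*}

/-- The variables of the two-row model: `(p, a)`, `p ∈ {0,1}` the row, `a ∈ τ` the column. [folklore] -/
abbrev Var (τ : Type*) : Type _ := Fin 2 × τ

variable (k τ) in
/-- The `k`-derivations of the two-row polynomial ring (abbreviation). [folklore] -/
abbrev Der : Type _ := Derivation k (MvPolynomial (Var τ) k) (MvPolynomial (Var τ) k)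

/-- Applying a finite sum of derivations (plumbing). [folklore] -/
private theorem finset_sum_apply {ι : Type*} (s : Finset ι) (D : ι → Der k τ) (f : MvPolynomial (Var τ) k) :
    (∑ i ∈ s, D i) f = ∑ i ∈ s, D i f := by
  have h : ⇑(∑ i ∈ s, D i) = ∑ i ∈ s, ⇑(D i) := map_sum Derivation.coeFnAddMonoidHom D s
  rw [h, Finset.sum_apply]

/-! ### Weights: the degree in the variables of one row -/

/-- The weight "degree in the row-`p` variables": `1` on `X_{(p,a)}`, `0` on the other row. [folklore] -/
def rowWt (p : Fin 2) : Var τ → ℕ := fun v => if v.1 = p then 1 else 0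

/-- Unfolding `rowWt` (plumbing). [folklore] -/
@[simp] private theorem rowWt_apply (p : Fin 2) (v : Var τ) : rowWt p v = if v.1 = p then 1 else 0 := rfl

/-! ### Polarization and Euler operators -/

/-- The **polarization operator** `polar p q = Σ_a X_{(p,a)} ∂/∂X_{(q,a)}`: the unique `k`-derivation of
`k[X_{(r,a)}]` with `X_{(q,a)} ↦ X_{(p,a)}` and `X_{(r,a)} ↦ 0` for `r ≠ q` (for `p ≠ q`; "replace one
letter `q` by `p`", Fulton–Harris §8.2 `E_{pq}`). [cite: FultonHarrisGTM129, §8.2 and §15.3] -/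
def polar (p q : Fin 2) : Der k τ :=
  MvPolynomial.mkDerivation k fun v => if v.1 = q then X (p, v.2) else 0

/-- The **Euler operator** of row `p`: `euler p = Σ_a X_{(p,a)} ∂/∂X_{(p,a)}`, the derivation with
`X_{(p,a)} ↦ X_{(p,a)}`, `X_{(r,a)} ↦ 0` (`r ≠ p`); the diagonal polarization `E_{pp}`.
[cite: FultonHarrisGTM129, §8.2 and §15.3] -/
def euler (p : Fin 2) : Der k τ :=
  MvPolynomial.mkDerivation k fun v => if v.1 = p then X v else 0

/-- The polarization on a variable: `X_{(q,a)} ↦ X_{(p,a)}`, other variables to `0`.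
[cite: FultonHarrisGTM129, §8.2 and §15.3] -/
@[simp] theorem polar_X (p q : Fin 2) (v : Var τ) :
    (polar p q : Der k τ) (X v) = if v.1 = q then X (p, v.2) else 0 := by
  simp [polar, mkDerivation_X]

/-- The Euler operator on a variable. [cite: FultonHarrisGTM129, §8.2 and §15.3] -/
@[simp] theorem euler_X (p : Fin 2) (v : Var τ) :
    (euler p : Der k τ) (X v) = if v.1 = p then X v else 0 := by
  simp [euler, mkDerivation_X]

/-- `[polar p q, polar q p] = euler p - euler q` for `p ≠ q` (the relation `[E, F] = H` of `sl₂`).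
[cite: FultonHarrisGTM129, §11.1] -/
theorem lie_polar_polar {p q : Fin 2} (hpq : p ≠ q) :
    ⁅(polar p q : Der k τ), (polar q p : Der k τ)⁆ = euler p - euler q := by
  refine MvPolynomial.derivation_ext fun v => ?_
  obtain ⟨r, a⟩ := v
  rw [Derivation.commutator_apply, Derivation.sub_apply]
  by_cases hr : r = p
  · subst hr
    simp [hpq]
  · have hrq : r = q := by
      fin_cases p <;> fin_cases q <;> fin_cases r <;> simp_all
    subst hrq
    simp [hr]

/-- `[euler p - euler q, polar q p] = -2 • polar q p` for `p ≠ q` (the relation `[H, F] = -2F`).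
[cite: FultonHarrisGTM129, §11.1] -/
theorem lie_euler_polar {p q : Fin 2} (hpq : p ≠ q) :
    ⁅(euler p - euler q : Der k τ), (polar q p : Der k τ)⁆ = -(2 • polar q p) := by
  refine MvPolynomial.derivation_ext fun v => ?_
  obtain ⟨r, a⟩ := v
  rw [Derivation.commutator_apply, Derivation.neg_apply, Derivation.smul_apply, Derivation.sub_apply,
    Derivation.sub_apply]
  by_cases hr : r = p
  · subst hr
    simp [hpq, Ne.symm hpq, two_smul]
    ring
  · have hrq : r = q := by
      fin_cases p <;> fin_cases q <;> fin_cases r <;> simp_all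
    subst hrq
    simp [hr]

/-- The Euler operator as the Euler sum `Σ_v w_p(v) X_v ∂/∂X_v`. [cite: FultonHarrisGTM129, §8.2 and §15.3] -/
theorem euler_eq_sum [Fintype τ] [DecidableEq τ] (p : Fin 2) :
    (euler p : Der k τ) = ∑ v : Var τ, ((rowWt p v : ℕ) : MvPolynomial (Var τ) k) •
      ((X v : MvPolynomial (Var τ) k) • (pderiv v : Der k τ)) := by
  refine MvPolynomial.derivation_ext fun i => ?_
  rw [euler_X, finset_sum_apply]
  simp only [Derivation.smul_apply, smul_eq_mul, pderiv_X, Pi.single_apply, mul_ite, mul_one,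
    mul_zero, Finset.sum_ite_eq, Finset.mem_univ, if_true, rowWt_apply]
  split_ifs <;> simp

/-- Euler's identity in the two-row model: on a polynomial of degree `n` in the row-`p` variables the
Euler operator of row `p` is multiplication by `n` (Euler's identity). [cite: FultonHarrisGTM129, §8.2 and §15.3] -/
theorem euler_apply_of_mem {p : Fin 2} {n : ℕ} {f : MvPolynomial (Var τ) k} [Fintype τ]
    (hf : f ∈ weightedHomogeneousSubmodule k (rowWt p) n) : (euler p : Der k τ) f = (n : k) • f := by
  classical
  have heul := IsWeightedHomogeneous.sum_weight_X_mul_pderiv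
    ((mem_weightedHomogeneousSubmodule k (rowWt p) n f).1 hf)
  rw [euler_eq_sum, finset_sum_apply, Nat.cast_smul_eq_nsmul, ← heul]
  refine Finset.sum_congr rfl fun v _ => ?_
  rw [Derivation.smul_apply, Derivation.smul_apply, smul_eq_mul, smul_eq_mul, nsmul_eq_mul]

/-! ### The unipotent shears and their parametrised form -/

/-- The shear `X_{(q,a)} ↦ X_{(q,a)} + t X_{(p,a)}` (`a ∈ τ`), the other row fixed: the substitution by
the unipotent matrix `1 + t e_{pq}` in the row index. [cite: GoodmanWallachGTM255, §1.3 and §2.3.1] -/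
def shear (p q : Fin 2) (t : k) : MvPolynomial (Var τ) k →ₐ[k] MvPolynomial (Var τ) k :=
  aeval fun v => if v.1 = q then X v + C t * X (p, v.2) else X v

/-- The same shear with a POLYNOMIAL parameter `T = X none` (plumbing def). [folklore] -/
def shearT (p q : Fin 2) : MvPolynomial (Var τ) k →ₐ[k] MvPolynomial (Option (Var τ)) k :=
  aeval fun v => if v.1 = q then X (some v) + X none * X (some (p, v.2)) else X (some v)

/-- Specialisation of the parameter: `T ↦ t`, `X_{some v} ↦ X_v` (plumbing def). [folklore] -/
def evalT (t : k) : MvPolynomial (Option (Var τ)) k →ₐ[k] MvPolynomial (Var τ) k :=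
  aeval fun o => o.elim (C t) X

/-- The shear on a variable. [cite: GoodmanWallachGTM255, §1.3 and §2.3.1] -/
@[simp] theorem shear_X (p q : Fin 2) (t : k) (v : Var τ) :
    shear p q t (X v) = if v.1 = q then X v + C t * X (p, v.2) else X v := by
  simp [shear]

/-- The parametrised shear on a variable (plumbing). [folklore] -/
@[simp] private theorem shearT_X (p q : Fin 2) (v : Var τ) :
    shearT (k := k) p q (X v) =
      if v.1 = q then X (some v) + X none * X (some (p, v.2)) else X (some v) := by
  simp [shearT]

/-- `evalT` on the parameter (plumbing). [folklore] -/
@[simp] private theorem evalT_X_none (t : k) : evalT (τ := τ) t (X none) = C t := by simp [evalT]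

/-- `evalT` on an ordinary variable (plumbing). [folklore] -/
@[simp] private theorem evalT_X_some (t : k) (v : Var τ) : evalT t (X (some v)) = X v := by simp [evalT]

/-- Specialising the parameter of `shearT` gives the shear (plumbing). [folklore] -/
private theorem evalT_comp_shearT (p q : Fin 2) (t : k) :
    (evalT t).comp (shearT (τ := τ) p q) = shear p q t := by
  refine MvPolynomial.algHom_ext fun v => ?_
  simp only [AlgHom.comp_apply, shearT_X, shear_X]
  split_ifs <;> simp [mul_comm]

/-- Specialising the parameter of `shearT` gives the shear, applied form (plumbing). [folklore] -/
private theorem evalT_shearT (p q : Fin 2) (t : k) (f : MvPolynomial (Var τ) k) :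
    evalT t (shearT p q f) = shear p q t f := by
  rw [← evalT_comp_shearT]; rfl

/-- `evalT` on a parameter-free polynomial (plumbing). [folklore] -/
@[simp] private theorem evalT_rename_some (t : k) (f : MvPolynomial (Var τ) k) :
    evalT t (rename some f) = f := by
  rw [evalT, aeval_rename]
  exact (aeval_X_left_apply f)

/-- The shear with parameter `0` is the identity. [cite: GoodmanWallachGTM255, §1.3 and §2.3.1] -/
@[simp] theorem shear_zero (p q : Fin 2) (f : MvPolynomial (Var τ) k) : shear p q 0 f = f := by
  have : shear (τ := τ) p q (0 : k) = AlgHom.id k _ := by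
    refine MvPolynomial.algHom_ext fun v => ?_
    simp
  rw [this]; rfl

/-- `∂/∂T (rename some f) = 0`: a polynomial not involving `T` (plumbing). [folklore] -/
private theorem pderiv_none_rename_some (f : MvPolynomial (Var τ) k) :
    pderiv none (rename (some : Var τ → Option (Var τ)) f) = 0 := by
  classical
  induction f using MvPolynomial.induction_on with
  | C a => simp
  | add f g hf hg => simp [hf, hg]
  | mul_X f v hf =>
    rw [map_mul, rename_X, Derivation.leibniz, hf, pderiv_X]
    simp

/-- **`∂/∂T ∘ shearT = shearT ∘ polar`**: the parametrised shear exponentiates the polarization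
operator (`p ≠ q`). [cite: GoodmanWallachGTM255, §1.3] -/
theorem pderiv_none_shearT {p q : Fin 2} (hpq : p ≠ q) (f : MvPolynomial (Var τ) k) :
    pderiv none (shearT p q f) = shearT p q (polar p q f) := by
  classical
  induction f using MvPolynomial.induction_on with
  | C a => simp [shearT]
  | add f g hf hg => simp [hf, hg]
  | mul_X f v hf =>
    rw [map_mul, Derivation.leibniz, Derivation.leibniz, hf, map_add]
    simp only [smul_eq_mul, map_mul, shearT_X, polar_X]
    obtain ⟨r, a⟩ := v
    by_cases hr : r = q
    · subst hr
      simp [hpq, Derivation.leibniz, pderiv_X, Pi.single_eq_of_ne, Pi.single_eq_same]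
    · simp [hr, pderiv_X]

/-! ### Constancy in the parameter -/

/-- A polynomial in `T` over `k[X]` all of whose specialisations `T ↦ t ∈ k` vanish is zero (`k`
infinite) (plumbing). [folklore] -/
private theorem eq_zero_of_forall_evalT [Infinite k] {R : MvPolynomial (Option (Var τ)) k}
    (h : ∀ t : k, evalT t R = 0) : R = 0 := by
  classical
  set P := optionEquivLeft k (Var τ) R with hP
  have hev : ∀ t : k, Polynomial.eval (C t) P = evalT t R := by
    intro t
    have hφ : (Polynomial.evalRingHom (C t : MvPolynomial (Var τ) k)).comp
        (optionEquivLeft k (Var τ)).toAlgHom.toRingHom = (evalT (τ := τ) t).toRingHom := by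
      refine MvPolynomial.ringHom_ext (fun a => ?_) (fun o => ?_)
      · simp
      · cases o with
        | none => simp
        | some v => simp
    have h2 := RingHom.congr_fun hφ R
    simpa [hP] using h2
  have hP0 : P = 0 := by
    refine Polynomial.eq_zero_of_infinite_isRoot P ?_
    have hsub : Set.range (fun t : k => (C t : MvPolynomial (Var τ) k)) ⊆ {x | P.IsRoot x} := by
      rintro _ ⟨t, rfl⟩
      simp [Polynomial.IsRoot, hev t, h t]
    exact Set.Infinite.mono hsub (Set.infinite_range_of_injective (C_injective _ _))
  have : R = (optionEquivLeft k (Var τ)).symm P := by rw [hP, AlgEquiv.symm_apply_apply]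
  rw [this, hP0, map_zero]

/-- `optionEquivLeft` turns `∂/∂T` into the derivative of polynomials (plumbing). [folklore] -/
private theorem optionEquivLeft_pderiv_none (R : MvPolynomial (Option (Var τ)) k) :
    optionEquivLeft k (Var τ) (pderiv none R) = Polynomial.derivative (optionEquivLeft k (Var τ) R) := by
  classical
  induction R using MvPolynomial.induction_on with
  | C a => simp
  | add f g hf hg => simp [hf, hg]
  | mul_X f o hf =>
    rw [Derivation.leibniz, map_add, map_mul, Polynomial.derivative_mul, ← hf]
    cases o with
    | none =>
      simp [pderiv_X, Pi.single_eq_same]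
      ring
    | some v =>
      simp [pderiv_X]
      ring

/-- A polynomial in `T` over `k[X]` with `∂/∂T = 0` does not depend on `T` (characteristic `0`;
plumbing). [folklore] -/
private theorem evalT_eq_evalT_zero_of_pderiv [CharZero k] {R : MvPolynomial (Option (Var τ)) k}
    (h : pderiv none R = 0) (t : k) : evalT t R = evalT 0 R := by
  classical
  set P := optionEquivLeft k (Var τ) R with hP
  have hder : Polynomial.derivative P = 0 := by
    rw [hP, ← optionEquivLeft_pderiv_none, h, map_zero]
  have hPC : P = Polynomial.C (P.coeff 0) := Polynomial.eq_C_of_derivative_eq_zero hder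
  have hR : R = rename some (P.coeff 0) := by
    have : R = (optionEquivLeft k (Var τ)).symm P := by rw [hP, AlgEquiv.symm_apply_apply]
    rw [this, hPC]
    simp [optionEquivLeft_symm_apply, Polynomial.aevalTower_C]
  rw [hR, evalT_rename_some, evalT_rename_some]

/-! ### Shear-fixed `⇔` killed by the polarization -/

/-- **Fixed by every shear `⇒` killed by the polarization** (`p ≠ q`, `k` infinite).
[cite: GoodmanWallachGTM255, §1.3 and §2.3.1] -/
theorem polar_eq_zero_of_forall_shear [Infinite k] {p q : Fin 2} (hpq : p ≠ q)
    {f : MvPolynomial (Var τ) k} (h : ∀ t : k, shear p q t f = f) : polar p q f = 0 := by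
  have hR : shearT p q f - rename some f = 0 := by
    refine eq_zero_of_forall_evalT fun t => ?_
    rw [map_sub, evalT_shearT, evalT_rename_some, h t, sub_self]
  have h1 : shearT p q (polar p q f) = 0 := by
    rw [← pderiv_none_shearT hpq, sub_eq_zero.1 hR, pderiv_none_rename_some]
  have h2 := congrArg (evalT (0 : k)) h1
  rwa [evalT_shearT, shear_zero, map_zero] at h2

/-- **Killed by the polarization `⇒` fixed by every shear** (`p ≠ q`, characteristic `0`).
[cite: GoodmanWallachGTM255, §1.3 and §2.3.1] -/
theorem shear_eq_self_of_polar_eq_zero [CharZero k] {p q : Fin 2} (hpq : p ≠ q)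
    {f : MvPolynomial (Var τ) k} (h : polar p q f = 0) (t : k) : shear p q t f = f := by
  have hd : pderiv none (shearT p q f) = 0 := by
    rw [pderiv_none_shearT hpq, h, map_zero]
  have := evalT_eq_evalT_zero_of_pderiv hd t
  rwa [evalT_shearT, evalT_shearT, shear_zero] at this

/-! ### The `sl₂` string and the nilpotency of the polarization -/

/-- `H F^n f = -2n F^n f` for `H f = 0`, where `F = polar q p`, `H = euler p - euler q`.
[cite: FultonHarrisGTM129, §11.1] -/
theorem euler_sub_polar_iterate {p q : Fin 2} (hpq : p ≠ q) {f : MvPolynomial (Var τ) k}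
    (hH : (euler p - euler q : Der k τ) f = 0) (n : ℕ) :
    (euler p - euler q : Der k τ) ((polar q p : Der k τ)^[n] f) =
      (-(2 * n : ℕ) : k) • (polar q p : Der k τ)^[n] f := by
  induction n with
  | zero => simpa using hH
  | succ n ih =>
    have hcomm := congrArg (fun D : Der k τ => D ((polar q p : Der k τ)^[n] f))
      (lie_euler_polar (k := k) (τ := τ) hpq)
    simp only [Derivation.commutator_apply, Derivation.neg_apply, Derivation.smul_apply] at hcomm
    rw [Function.iterate_succ_apply', sub_eq_iff_eq_add.1 hcomm, ih, Derivation.map_smul, two_smul,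
      smul_eq_C_mul, smul_eq_C_mul]
    push_cast
    simp only [map_neg, map_mul, map_add, map_natCast, map_ofNat, map_one]
    ring

/-- The `sl₂` string: `E F^{n+1} f = -(n(n+1)) F^n f` for `E f = 0`, `H f = 0` (`E = polar p q`,
`F = polar q p`, `H = euler p - euler q`). [cite: FultonHarrisGTM129, §11.1 (Lemma 11.4)] -/
theorem polar_iterate_succ {p q : Fin 2} (hpq : p ≠ q) {f : MvPolynomial (Var τ) k}
    (hE : (polar p q : Der k τ) f = 0) (hH : (euler p - euler q : Der k τ) f = 0) (n : ℕ) :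
    (polar p q : Der k τ) ((polar q p : Der k τ)^[n + 1] f) =
      (-((n + 1) * n : ℕ) : k) • (polar q p : Der k τ)^[n] f := by
  induction n with
  | zero =>
    have hcomm := congrArg (fun D : Der k τ => D f) (lie_polar_polar (k := k) (τ := τ) hpq)
    simp only [Derivation.commutator_apply] at hcomm
    rw [hE, map_zero, sub_zero, hH] at hcomm
    simp [hcomm]
  | succ n ih =>
    have hcomm := congrArg (fun D : Der k τ => D ((polar q p : Der k τ)^[n + 1] f))
      (lie_polar_polar (k := k) (τ := τ) hpq)
    simp only [Derivation.commutator_apply] at hcomm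
    rw [Function.iterate_succ_apply', sub_eq_iff_eq_add.1 hcomm, ih, Derivation.map_smul,
      euler_sub_polar_iterate hpq hH (n + 1), ← Function.iterate_succ_apply' (polar q p : Der k τ) n f,
      ← add_smul]
    congr 1
    push_cast
    ring

/-- The polarization as a sum of partial derivatives: `polar q p = Σ_a X_{(q,a)} ∂/∂X_{(p,a)}`
(`τ` finite). [cite: FultonHarrisGTM129, §8.2 and §15.3] -/
theorem polar_eq_sum [Fintype τ] [DecidableEq τ] (p q : Fin 2) :
    (polar q p : Der k τ) = ∑ a : τ, (X (q, a) : MvPolynomial (Var τ) k) • (pderiv (p, a) : Der k τ) := by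
  refine MvPolynomial.derivation_ext fun i => ?_
  obtain ⟨r, b⟩ := i
  rw [polar_X, finset_sum_apply]
  simp only [Derivation.smul_apply, smul_eq_mul, pderiv_X, Pi.single_apply, Prod.mk.injEq, mul_ite,
    mul_one, mul_zero]
  by_cases hr : r = p
  · subst hr
    simp [Finset.sum_ite_eq]
  · simp [hr]

/-- `polar q p f = Σ_a X_{(q,a)} ∂f/∂X_{(p,a)}`. [cite: FultonHarrisGTM129, §8.2 and §15.3] -/
theorem polar_apply_eq_sum [Fintype τ] [DecidableEq τ] (p q : Fin 2) (f : MvPolynomial (Var τ) k) :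
    (polar q p : Der k τ) f = ∑ a : τ, X (q, a) * pderiv (p, a) f := by
  rw [polar_eq_sum, finset_sum_apply]
  simp only [Derivation.smul_apply, smul_eq_mul]

/-- The polarization `polar q p` lowers the degree in the row-`p` variables by one (`F` lowers the
weight). [cite: FultonHarrisGTM129, §11.1] -/
theorem polar_mem_of_mem [Fintype τ] {p q : Fin 2} (hpq : p ≠ q) {n : ℕ}
    {f : MvPolynomial (Var τ) k} (hf : f ∈ weightedHomogeneousSubmodule k (rowWt p) (n + 1)) :
    (polar q p : Der k τ) f ∈ weightedHomogeneousSubmodule k (rowWt p) n := by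
  classical
  rw [polar_apply_eq_sum]
  refine Submodule.sum_mem _ fun a _ => ?_
  rw [mem_weightedHomogeneousSubmodule]
  have h1 : IsWeightedHomogeneous (rowWt p) (X (q, a) : MvPolynomial (Var τ) k) 0 := by
    have := isWeightedHomogeneous_X k (rowWt (τ := τ) p) (q, a)
    simpa [rowWt, Ne.symm hpq, hpq] using this
  have h2 : IsWeightedHomogeneous (rowWt p) (pderiv (p, a) f) n :=
    ((mem_weightedHomogeneousSubmodule k (rowWt p) (n + 1) f).1 hf).pderiv (by simp [rowWt])
  simpa using h1.mul h2

/-- A polynomial of degree `0` in the row-`p` variables is killed by `polar q p`.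
[cite: FultonHarrisGTM129, §11.1] -/
theorem polar_eq_zero_of_mem_zero [Fintype τ] {p q : Fin 2}
    {f : MvPolynomial (Var τ) k} (hf : f ∈ weightedHomogeneousSubmodule k (rowWt p) 0) :
    (polar q p : Der k τ) f = 0 := by
  classical
  have hvars : ∀ a : τ, (p, a) ∉ f.vars := by
    intro a ha
    rw [mem_vars_iff_mem_support] at ha
    obtain ⟨d, hd, hda⟩ := ha
    have hw := ((mem_weightedHomogeneousSubmodule k (rowWt p) 0 f).1 hf) (mem_support_iff.1 hd)
    have hle := Finsupp.le_weight (rowWt (τ := τ) p) (s := (p, a)) (by simp [rowWt]) d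
    rw [hw] at hle
    exact (Finsupp.mem_support_iff.1 hda) (Nat.le_zero.1 hle)
  rw [polar_apply_eq_sum]
  refine Finset.sum_eq_zero fun a _ => ?_
  rw [pderiv_eq_zero_of_notMem_vars (hvars a), mul_zero]

/-- Nilpotency: `(polar q p)^{δ+1} f = 0` for `f` of degree `δ` in the row-`p` variables.
[cite: FultonHarrisGTM129, §11.1] -/
theorem iterate_polar_eq_zero [Fintype τ] {p q : Fin 2} (hpq : p ≠ q) {δ : ℕ}
    {f : MvPolynomial (Var τ) k} (hf : f ∈ weightedHomogeneousSubmodule k (rowWt p) δ) :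
    (polar q p : Der k τ)^[δ + 1] f = 0 := by
  -- induction on the degree
  suffices h : ∀ m : ℕ, ∀ g : MvPolynomial (Var τ) k,
      g ∈ weightedHomogeneousSubmodule k (rowWt p) m → (polar q p : Der k τ)^[m + 1] g = 0 from h δ f hf
  intro m
  induction m with
  | zero =>
    intro g hg
    simp [polar_eq_zero_of_mem_zero hg]
  | succ m ih =>
    intro g hg
    rw [Function.iterate_succ_apply]
    exact ih _ (polar_mem_of_mem hpq hg)

/-- **`E f = 0`, bidegree `(δ, δ)` `⇒` `F f = 0`**: a polynomial of bidegree `(δ, δ)` killed by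
`polar p q` is killed by `polar q p` (characteristic `0`). Downward induction on the string
`E F^{n+1} f = -n(n+1) F^n f`, started at `F^{δ+1} f = 0`. [cite: FultonHarrisGTM129, §11.1] -/
theorem polar_swap_eq_zero [Fintype τ] [CharZero k] {p q : Fin 2} (hpq : p ≠ q) {δ : ℕ}
    {f : MvPolynomial (Var τ) k} (hE : (polar p q : Der k τ) f = 0)
    (hp : f ∈ weightedHomogeneousSubmodule k (rowWt p) δ)
    (hq : f ∈ weightedHomogeneousSubmodule k (rowWt q) δ) : (polar q p : Der k τ) f = 0 := by
  have hH : (euler p - euler q : Der k τ) f = 0 := by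
    rw [Derivation.sub_apply, euler_apply_of_mem hp, euler_apply_of_mem hq, sub_self]
  -- downward induction: `F^[n] f = 0` for all `n ≥ 1`
  have key : ∀ j : ℕ, (polar q p : Der k τ)^[δ + 1 - j] f = 0 ∨ δ + 1 - j = 0 := by
    intro j
    induction j with
    | zero => exact Or.inl (by simpa using iterate_polar_eq_zero hpq hp)
    | succ j ih =>
      rcases ih with h | h
      · by_cases hj : δ + 1 - (j + 1) = 0
        · exact Or.inr hj
        · left
          -- `δ + 1 - j = (δ - j) + 1` and `δ + 1 - (j+1) = δ - j` with `n := δ - j ≥ 1`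
          obtain ⟨n, hn⟩ : ∃ n, δ + 1 - (j + 1) = n + 1 := ⟨δ + 1 - (j + 1) - 1, by omega⟩
          have hprev : δ + 1 - j = n + 1 + 1 := by omega
          rw [hprev] at h
          have hs := polar_iterate_succ hpq hE hH (n + 1)
          rw [h, map_zero] at hs
          have hpos : 0 < (n + 1 + 1) * (n + 1) := by positivity
          have hne : (-((n + 1 + 1) * (n + 1) : ℕ) : k) ≠ 0 := by
            rw [neg_ne_zero]; exact_mod_cast hpos.ne'
          rw [hn]
          exact (smul_eq_zero.1 hs.symm).resolve_left hne
      · exact Or.inr (by omega)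
  rcases key δ with h | h
  · simpa using h
  · omega

/-! ### From the root groups to `SL₂` -/

/-- Substitution of the ROW index by a `2 × 2` matrix: `X_{(q,a)} ↦ Σ_p g_{p q} X_{(p,a)}` (column
convention, as the tree's `linSubst` / `legSubst₁`): the action of `GL₂` on `Sym(k² ⊗ k^τ)`.
[cite: FultonHarrisGTM129, §15.3] -/
def rowSubst (g : Matrix (Fin 2) (Fin 2) k) : MvPolynomial (Var τ) k →ₐ[k] MvPolynomial (Var τ) k :=
  aeval fun v => ∑ p : Fin 2, g p v.1 • X (p, v.2)

/-- `rowSubst` on a variable. [cite: FultonHarrisGTM129, §15.3] -/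
@[simp] theorem rowSubst_X (g : Matrix (Fin 2) (Fin 2) k) (v : Var τ) :
    rowSubst g (X v) = ∑ p : Fin 2, g p v.1 • X (p, v.2) := by
  simp [rowSubst]

/-- `rowSubst (g h) = rowSubst g ∘ rowSubst h` (it is an action). [cite: FultonHarrisGTM129, §15.3] -/
theorem rowSubst_mul (g h : Matrix (Fin 2) (Fin 2) k) :
    rowSubst (τ := τ) (g * h) = (rowSubst g).comp (rowSubst h) := by
  refine MvPolynomial.algHom_ext fun v => ?_
  simp only [rowSubst_X, AlgHom.comp_apply, map_sum, map_smul, Matrix.mul_apply, Finset.sum_smul,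
    Finset.smul_sum, smul_smul]
  rw [Finset.sum_comm]
  refine Finset.sum_congr rfl fun p _ => Finset.sum_congr rfl fun r _ => ?_
  ring_nf

/-- The upper shear is the substitution by the unipotent `!![1, t; 0, 1]`.
[cite: GoodmanWallachGTM255, §1.3 and §2.3.1] -/
theorem rowSubst_upper (t : k) : rowSubst (τ := τ) !![1, t; 0, 1] = shear 0 1 t := by
  refine MvPolynomial.algHom_ext fun v => ?_
  obtain ⟨r, a⟩ := v
  simp only [rowSubst_X, shear_X, Fin.sum_univ_two]
  fin_cases r <;> simp [smul_eq_C_mul, add_comm]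

/-- The lower shear is the substitution by the unipotent `!![1, 0; t, 1]`.
[cite: GoodmanWallachGTM255, §1.3 and §2.3.1] -/
theorem rowSubst_lower (t : k) : rowSubst (τ := τ) !![1, 0; t, 1] = shear 1 0 t := by
  refine MvPolynomial.algHom_ext fun v => ?_
  obtain ⟨r, a⟩ := v
  simp only [rowSubst_X, shear_X, Fin.sum_univ_two]
  fin_cases r <;> simp [smul_eq_C_mul]

/-- Scaling the variables of a weighted-homogeneous polynomial: `f(c^{w} X) = c^n f` (a weight vector
of the torus). [cite: FultonHarrisGTM129, §15.3] -/
theorem aeval_scale_of_mem {σ : Type*} {w : σ → ℕ} {n : ℕ} (c : k) {f : MvPolynomial σ k}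
    (hf : f ∈ weightedHomogeneousSubmodule k w n) :
    aeval (fun v => C (c ^ w v) * X v) f = C (c ^ n) * f := by
  classical
  rw [weightedHomogeneousSubmodule_eq_finsupp_supported, AddMonoidAlgebra.supported_eq_span_single] at hf
  refine Submodule.span_induction ?_ ?_ (fun p q _ _ hp hq => ?_) (fun r p _ h => ?_) hf
  · rintro _ ⟨m, hm, rfl⟩
    change aeval _ (monomial m (1 : k)) = C (c ^ n) * monomial m 1
    rw [aeval_monomial, map_one, one_mul]
    simp_rw [mul_pow]
    rw [Finsupp.prod_mul, Finsupp.prod, Finsupp.prod, prod_X_pow_eq_monomial]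
    simp_rw [← map_pow, ← pow_mul]
    rw [← map_prod, Finset.prod_pow_eq_pow_sum]
    congr 3
    rw [Set.mem_setOf_eq, Finsupp.weight_apply, Finsupp.sum] at hm
    rw [← hm]
    exact Finset.sum_congr rfl fun i _ => by rw [smul_eq_mul, mul_comm]
  · simp
  · rw [map_add, hp, hq, mul_add]
  · rw [map_smul, h, smul_eq_C_mul, smul_eq_C_mul]; ring

/-- The diagonal torus element `diag(s, s')` acts on a polynomial of bidegree `(m, n)` by `s^m s'^n`
(bihomogeneous polynomials are weight vectors). [cite: FultonHarrisGTM129, §15.3] -/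
theorem rowSubst_diagonal [Fintype τ] (s s' : k) {m n : ℕ} {f : MvPolynomial (Var τ) k}
    (h0 : f ∈ weightedHomogeneousSubmodule k (rowWt 0) m)
    (h1 : f ∈ weightedHomogeneousSubmodule k (rowWt 1) n) :
    rowSubst (Matrix.diagonal ![s, s']) f = C (s ^ m * s' ^ n) * f := by
  have hcomp : rowSubst (τ := τ) (Matrix.diagonal ![s, s']) =
      (aeval fun v => C (s ^ rowWt (0 : Fin 2) v) * X v).comp
        (aeval fun v => C (s' ^ rowWt (1 : Fin 2) v) * X v) := by
    refine MvPolynomial.algHom_ext fun v => ?_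
    obtain ⟨r, a⟩ := v
    simp only [rowSubst_X, AlgHom.comp_apply, Fin.sum_univ_two, Matrix.diagonal_apply]
    fin_cases r <;> simp [smul_eq_C_mul, rowWt]
  rw [hcomp, AlgHom.comp_apply, aeval_scale_of_mem s' h1, map_mul, aeval_C, algebraMap_eq,
    aeval_scale_of_mem s h0, ← mul_assoc, ← map_mul, mul_comm (s' ^ n)]

/-- **Unipotent-fixed of bidegree `(δ, δ)` `⇒` `SL₂`-fixed.** If `f ∈ k[X_{(p,a)}]` (characteristic `0`)
has degree `δ` in each row and is fixed by all upper shears `X_{(1,a)} ↦ X_{(1,a)} + t X_{(0,a)}`, then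
`rowSubst g f = f` for every `g` with `det g = 1`. [cite: FultonHarrisGTM129, §11.1] -/
theorem rowSubst_eq_self_of_shear [Fintype τ] [CharZero k] {δ : ℕ} {f : MvPolynomial (Var τ) k}
    (hU : ∀ t : k, shear 0 1 t f = f)
    (h0 : f ∈ weightedHomogeneousSubmodule k (rowWt 0) δ)
    (h1 : f ∈ weightedHomogeneousSubmodule k (rowWt 1) δ)
    (g : Matrix (Fin 2) (Fin 2) k) (hg : g.det = 1) : rowSubst g f = f := by
  have h01 : (0 : Fin 2) ≠ 1 := by decide
  have hE : polar 0 1 f = 0 := polar_eq_zero_of_forall_shear h01 hU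
  have hF : polar 1 0 f = 0 := polar_swap_eq_zero h01 hE h0 h1
  have hL : ∀ t : k, shear 1 0 t f = f := shear_eq_self_of_polar_eq_zero (Ne.symm h01) hF
  have hD : ∀ a : k, a ≠ 0 → rowSubst (Matrix.diagonal ![a, a⁻¹]) f = f := by
    intro a ha
    rw [rowSubst_diagonal a a⁻¹ h0 h1, ← mul_pow, mul_inv_cancel₀ ha, one_pow, map_one, one_mul]
  have hD' : ∀ a : k, a ≠ 0 → rowSubst (τ := τ) !![a, 0; 0, a⁻¹] f = f := by
    intro a ha
    have : (!![a, 0; 0, a⁻¹] : Matrix (Fin 2) (Fin 2) k) = Matrix.diagonal ![a, a⁻¹] := by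
      ext i j; fin_cases i <;> fin_cases j <;> simp
    rw [this]; exact hD a ha
  -- the Bruhat-free factorisation `g = L(c/a) · diag(a, a⁻¹) · U(b/a)` when `a = g₀₀ ≠ 0`
  have hdet : g 0 0 * g 1 1 - g 0 1 * g 1 0 = 1 := by rw [← Matrix.det_fin_two, hg]
  have fac : ∀ h : Matrix (Fin 2) (Fin 2) k, h 0 0 ≠ 0 → h 0 0 * h 1 1 - h 0 1 * h 1 0 = 1 →
      rowSubst (τ := τ) h f = f := by
    intro h ha hdet
    have h11 : h 1 1 = (h 1 0 * h 0 1 + 1) / h 0 0 := by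
      rw [eq_div_iff ha]; linear_combination hdet
    have hLD : (!![1, 0; h 1 0 / h 0 0, 1] : Matrix (Fin 2) (Fin 2) k) * !![h 0 0, 0; 0, (h 0 0)⁻¹] =
        !![h 0 0, 0; h 1 0, (h 0 0)⁻¹] := by
      rw [Matrix.mul_fin_two, div_mul_cancel₀ _ ha]
      simp
    have hfac : h = !![1, 0; h 1 0 / h 0 0, 1] * !![h 0 0, 0; 0, (h 0 0)⁻¹] *
        !![1, h 0 1 / h 0 0; 0, 1] := by
      rw [hLD, Matrix.mul_fin_two, Matrix.eta_fin_two h]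
      simp only [mul_one, mul_zero, add_zero, mul_div_cancel₀ _ ha, Matrix.of_apply,
        Matrix.cons_val', Matrix.cons_val_zero, Matrix.cons_val_one, Matrix.empty_val',
        Matrix.cons_val_fin_one]
      congr 1
      rw [h11, mul_div_assoc', inv_eq_one_div, ← add_div]
    rw [hfac, rowSubst_mul, rowSubst_mul, AlgHom.comp_apply, AlgHom.comp_apply, rowSubst_upper, hU,
      hD' _ ha, rowSubst_lower, hL]
  by_cases ha : g 0 0 = 0
  · have hc : g 1 0 ≠ 0 := by
      intro hc; rw [ha, hc] at hdet; simp at hdet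
    -- one extra shear brings `g₁₀` to the corner
    set g' : Matrix (Fin 2) (Fin 2) k := !![1, 1; 0, 1] * g with hg'
    have hinv : (!![1, -1; 0, 1] : Matrix (Fin 2) (Fin 2) k) * !![1, 1; 0, 1] = 1 := by
      rw [Matrix.mul_fin_two, Matrix.one_fin_two]; norm_num
    have hgg : g = !![1, -1; 0, 1] * g' := by
      rw [hg', ← Matrix.mul_assoc, hinv, Matrix.one_mul]
    have hg'e : g' = !![g 0 0 + g 1 0, g 0 1 + g 1 1; g 1 0, g 1 1] := by
      rw [hg', Matrix.eta_fin_two g, Matrix.mul_fin_two]; simp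
    have h00 : g' 0 0 = g 1 0 := by rw [hg'e]; simp [ha]
    have h' : g' 0 0 * g' 1 1 - g' 0 1 * g' 1 0 = 1 := by
      rw [hg'e]; simp; linear_combination hdet
    rw [hgg, rowSubst_mul, AlgHom.comp_apply, fac _ (by rwa [h00]) h', rowSubst_upper, hU]
  · exact fac g ha hdet

end Literature.RepresentationTheory.ClassicalInvariants.TwoRowSl2
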